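import Summits.BirchSwinnertonDyer.Rank1Residual.Additive.TwistPartnerForcedTower
import Literature.NumberTheory.EllipticCurves.PAdicLFunctionInterpolationProofs
import Mathlib.NumberTheory.DirichletCharacter.Orthogonality
import Mathlib.RingTheory.RootsOfUnity.AlgebraicallyClosed
import HarnessLib

/-!
# The forced twist partner: PARITY (`Φ(−s) = χ(−1)Φ(s)`, its measure is even) and the character-sum
# TOOLS on `ℤ/pⁿ` (reflection, lifted characters, orthogonality) used to pin a measure by its rows
# (cell `b2b-bsdres`, sub-cell additive-p2 = X3♯(G-ord)/X4♯(G-ord), gen 25; sequel of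
# `TwistPartnerForced.lean` / `TwistPartnerForcedTower.lean`)

HONEST FRAMING (cell `b2b-bsdres`, run/shared/lean/b2b/bsd-rank1-residual/, verbatim in every
file): the goal of the cell is to DELETE the COMBINATION-SHAPED residual classes of the
Birch–Swinnerton-Dyer formula for ALL analytic-rank `≤ 1` elliptic curves over `ℚ` — "full BSD
formula for every rank `≤ 1` curve in class `C`" assembled STRICTLY from published theorems — so
that the rank-`≤ 1` remainder becomes exactly the CONSTRUCTION-SHAPED classes, which are TYPED
(missing-input `Prop`s), NOT attempted. This is not "finishing BSD". Sub-cell additive-p2: the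
classes X3♯(G-ord) / X4♯(G-ord) are CONSTRUCTION-SHAPED and stay so; labels / RESIDUAL-MAP marks
UNCHANGED; nothing is booked. Theorems only; no definition, no named fact, no `sorry`.

* §1 Tools on `ℤ/pⁿ` with `ℂ_p`-valued Dirichlet characters: reflection
  `∑_b ψ(b)g(−b) = ψ(−1)∑_b ψ(b)g(b)`; a non-primitive character
  of level `p^{m+1}` is lifted from level `p^m`, and a lifted character is the character of the
  reduction on all classes; ORTHOGONALITY: a function killed by every character mod `pⁿ` vanishes on
  the units (Mathlib `DirichletCharacter.sum_char_inv_mul_char_eq`; `ℂ_p` has enough roots of unity).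
* §2 Parity: for `x` EVEN and `1`-periodic (`x = [·]⁺_f`: `ratPlusSymbol_neg`), the source, tail,
  approximants and the FORCED partner of `TwistPartnerForced.lean` satisfy `F(−s) = χ(−1)·F(s)`
  (`forced_neg`), so the tame-branch measure `μ(a + pⁿℤ_p) = ã⁻ⁿχ̄(a)Φ(a/pⁿ)` of the forced partner is
  EVEN: `μ(−a + pⁿℤ_p) = μ(a + pⁿℤ_p)` (`twistPartnerMeasure_forced_neg`) — hence its rows against odd
  characters vanish, which is why the named fact `Delbourgo1998.thm1_exists_bounded_evenMeasure`
  transcribes EVEN rows only. Consumer: `TwistPartnerForcedOfMeasure.lean` (same gen).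

References: B. Mazur, J. Tate, J. Teitelbaum, Invent. Math. 84 (1986) §I.8, §I.10 (10.1)
[MazurTateTeitelbaum1986Invent].
-/

noncomputable section

open scoped Classical MatrixGroups ModularForm

open CongruenceSubgroup

namespace Summit.BirchSwinnertonDyer.Rank1Residual.Additive

open Literature.NumberTheory.EllipticCurves Literature.NumberTheory.EllipticCurves.ModularForms
  Literature.NumberTheory.EllipticCurves.Rank1Residual

namespace TwistPartner

/-! ### §1 Character-sum tools on `ℤ/pⁿ` -/

section Tools

variable {p : ℕ} [hp : Fact p.Prime]

/-- Reflection: `∑_b ψ(b) g(−b) = ψ(−1) ∑_b ψ(b) g(b)`. [folklore] -/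
theorem sum_mul_apply_neg_eq {n : ℕ} [NeZero n] (ψ : DirichletCharacter ℂ_[p] n)
    (g : ZMod n → ℂ_[p]) :
    ∑ b : ZMod n, ψ b * g (-b) = ψ (-1) * ∑ b : ZMod n, ψ b * g b := by
  have h : ∑ b : ZMod n, ψ b * g (-b) = ∑ b : ZMod n, ψ (-b) * g b :=
    Fintype.sum_equiv (Equiv.neg (ZMod n)) _ _ fun b ↦ by simp
  rw [h, Finset.mul_sum]
  refine Finset.sum_congr rfl fun b _ ↦ ?_
  rw [show ψ (-b) = ψ (-1 * b) by rw [neg_one_mul], map_mul]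
  ring

/-- A non-primitive character of level `p^{m+1}` is lifted from level `p^m`. [folklore] -/
theorem exists_eq_changeLevel_of_not_isPrimitive {m : ℕ}
    {ψ : DirichletCharacter ℂ_[p] (p ^ (m + 1))} (hψ : ¬ ψ.IsPrimitive) :
    ∃ ψ' : DirichletCharacter ℂ_[p] (p ^ m),
      ψ = DirichletCharacter.changeLevel (pow_dvd_pow p m.le_succ) ψ' := by
  haveI : NeZero (p ^ (m + 1)) := ⟨pow_ne_zero _ hp.out.ne_zero⟩
  obtain ⟨k, hk, hck⟩ := (Nat.dvd_prime_pow hp.out).mp ψ.conductor_dvd_level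
  have hkn : k ≠ m + 1 := fun h ↦ hψ ((DirichletCharacter.isPrimitive_def ψ).mpr (by rw [hck, h]))
  have hc : ψ.conductor ∣ p ^ m := by
    rw [hck]; exact pow_dvd_pow p (by omega)
  have hft : ψ.FactorsThrough (p ^ m) :=
    (ψ.mem_conductorSet_iff_conductor_dvd (pow_dvd_pow p m.le_succ)).mpr hc
  exact ⟨hft.χ₀, hft.eq_changeLevel⟩

/-- A lifted character is the character of the reduction on ALL classes (`1 ≤ m ≤ n`). [folklore] -/
theorem changeLevel_pow_apply {m n : ℕ} (hm : 1 ≤ m) (hmn : m ≤ n)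
    (ψ : DirichletCharacter ℂ_[p] (p ^ m)) (b : ZMod (p ^ n)) :
    DirichletCharacter.changeLevel (pow_dvd_pow p hmn) ψ b =
      ψ (ZMod.castHom (pow_dvd_pow p hmn) (ZMod (p ^ m)) b) := by
  by_cases hb : IsUnit b
  · obtain ⟨u, rfl⟩ := hb
    rw [DirichletCharacter.changeLevel_eq_cast_of_dvd ψ (pow_dvd_pow p hmn) u, ZMod.castHom_apply]
  · have hb' : ¬ IsUnit (ZMod.castHom (pow_dvd_pow p hmn) (ZMod (p ^ m)) b) := by
      rwa [← isUnit_iff_isUnit_castHom hm hmn b]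
    rw [MulChar.map_nonunit _ hb, MulChar.map_nonunit _ hb']

/-- **Orthogonality**: a function on `ℤ/pⁿ` killed by every Dirichlet character mod `pⁿ` (values in
`ℂ_p`) vanishes on the units. [folklore] -/
theorem apply_eq_zero_of_forall_sum_mul_eq_zero {n : ℕ} [NeZero (p ^ n)] {ν : ZMod (p ^ n) → ℂ_[p]}
    (h : ∀ ψ : DirichletCharacter ℂ_[p] (p ^ n), ∑ b : ZMod (p ^ n), ψ b * ν b = 0)
    {u : ZMod (p ^ n)} (hu : IsUnit u) : ν u = 0 := by
  haveI : NeZero ((Monoid.exponent (ZMod (p ^ n))ˣ : ℕ) : ℂ_[p]) :=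
    ⟨Nat.cast_ne_zero.mpr Monoid.exponent_ne_zero_of_finite⟩
  have hsum : ∑ ψ : DirichletCharacter ℂ_[p] (p ^ n),
      ψ u⁻¹ * ∑ b : ZMod (p ^ n), ψ b * ν b = 0 :=
    Finset.sum_eq_zero fun ψ _ ↦ by rw [h ψ, mul_zero]
  have hswap : ∑ ψ : DirichletCharacter ℂ_[p] (p ^ n), ψ u⁻¹ * ∑ b : ZMod (p ^ n), ψ b * ν b =
      ∑ b : ZMod (p ^ n), (∑ ψ : DirichletCharacter ℂ_[p] (p ^ n), ψ u⁻¹ * ψ b) * ν b := by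
    simp_rw [Finset.mul_sum, Finset.sum_mul, ← mul_assoc]
    exact Finset.sum_comm
  rw [hswap] at hsum
  simp_rw [DirichletCharacter.sum_char_inv_mul_char_eq ℂ_[p] hu, ite_mul, zero_mul,
    Finset.sum_ite_eq, Finset.mem_univ, if_true] at hsum
  have hφ : ((p ^ n).totient : ℂ_[p]) ≠ 0 :=
    Nat.cast_ne_zero.mpr (Nat.totient_pos.mpr (NeZero.pos _)).ne'
  exact (mul_eq_zero.mp hsum).resolve_left hφ

/-- A `ℚ_p`-valued character of `ℤ/p` takes unit values of norm `1`. [folklore] -/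
theorem norm_apply_eq_one_of_isUnit (χ : MulChar (ZMod p) ℚ_[p]) {a : ZMod p} (ha : IsUnit a) :
    ‖χ a‖ = 1 := by
  have h1 : (χ a) ^ (p - 1) = 1 := by
    rw [← map_pow, ZMod.pow_card_sub_one_eq_one ha.ne_zero, map_one]
  have h2 : ‖χ a‖ ^ (p - 1) = 1 := by rw [← norm_pow, h1, norm_one]
  have hp1 : p - 1 ≠ 0 := by have := hp.out.two_le; omega
  exact (pow_eq_one_iff_of_nonneg (norm_nonneg _) hp1).mp h2

/-- An integer prime to `p` is a unit mod `pⁿ`. [folklore] -/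
theorem isUnit_intCast_of_not_dvd {a : ℤ} (ha : ¬ (p : ℤ) ∣ a) (n : ℕ) :
    IsUnit ((a : ZMod (p ^ n))) := by
  rw [ZMod.coe_int_isUnit_iff_isCoprime]
  have hna : ¬ p ∣ a.natAbs := fun h ↦ ha (Int.natCast_dvd.mpr h)
  have hcop : Nat.Coprime (p ^ n) a.natAbs :=
    Nat.Coprime.pow_left n ((Nat.Prime.coprime_iff_not_dvd hp.out).mpr hna)
  have h := Nat.isCoprime_iff_coprime.mpr hcop
  rw [Int.natCast_natAbs] at h
  push_cast at h
  exact (IsCoprime.abs_right_iff _ _).mp h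

end Tools

/-! ### §2 Parity of the forced partner and of its measure -/

section Parity

variable {p : ℕ} [hp : Fact p.Prime] {χ : MulChar (ZMod p) ℚ_[p]} {x : ℚ → ℚ_[p]} {ã : ℚ_[p]}

/-- For `x` even and `1`-periodic: `x(−u + b/p) = x(u + (−b).val/p)` (`b ∈ ℤ/p`). [folklore] -/
theorem apply_neg_add_val_div (hperx : ∀ s, x (s + 1) = x s) (hevenx : ∀ s, x (-s) = x s)
    (u : ℚ) (b : ZMod p) :
    x (-u + (b.val : ℚ) / p) = x (u + ((-b).val : ℚ) / p) := by
  have hp0 : (p : ℚ) ≠ 0 := Nat.cast_ne_zero.mpr hp.out.ne_zero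
  rw [show -u + (b.val : ℚ) / p = -(u - (b.val : ℚ) / p) by ring, hevenx, ZMod.neg_val]
  split_ifs with hb
  · rw [hb, ZMod.val_zero, Nat.cast_zero, zero_div, sub_zero, add_zero]
  · have hle : b.val ≤ p := (ZMod.val_lt b).le
    rw [Nat.cast_sub hle, sub_div, div_self hp0]
    have h := hperx (u - (b.val : ℚ) / p)
    rw [← h]
    congr 1
    ring

/-- **The source is `χ(−1)`-symmetric**: `S(−u) = χ(−1)·S(u)` for `x` even and `1`-periodic. [folklore] -/
theorem source_neg (hperx : ∀ s, x (s + 1) = x s) (hevenx : ∀ s, x (-s) = x s) (u : ℚ) :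
    source χ x (-u) = χ (-1) * source χ x u := by
  simp only [source, CensusX43.twist]
  have h1 : ∑ b : ZMod p, χ b * x (-u + (b.val : ℚ) / p) =
      ∑ b : ZMod p, χ b * x (u + ((-b).val : ℚ) / p) :=
    Finset.sum_congr rfl fun b _ ↦ by rw [apply_neg_add_val_div hperx hevenx]
  have h2 : ∑ b : ZMod p, χ b * x (u + ((-b).val : ℚ) / p) =
      χ (-1) * ∑ b : ZMod p, χ b * x (u + (b.val : ℚ) / p) := by
    have h3 : ∑ b : ZMod p, χ b * x (u + ((-b).val : ℚ) / p) =
        ∑ b : ZMod p, χ (-b) * x (u + (b.val : ℚ) / p) :=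
      Fintype.sum_equiv (Equiv.neg (ZMod p)) _ _ fun b ↦ by simp
    rw [h3, Finset.mul_sum]
    refine Finset.sum_congr rfl fun b _ ↦ ?_
    rw [show χ (-b) = χ (-1 * b) by rw [neg_one_mul], map_mul]
    ring
  rw [h1, h2]
  ring

/-- The tail is `χ(−1)`-symmetric. [folklore] -/
theorem tail_neg (hperx : ∀ s, x (s + 1) = x s) (hevenx : ∀ s, x (-s) = x s) (t : ℚ) :
    tail χ x ã (-t) = χ (-1) * tail χ x ã t := by
  simp only [tail, Rat.den_neg_eq_den, mul_neg, source_neg hperx hevenx, Finset.mul_sum]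
  exact Finset.sum_congr rfl fun j _ ↦ by ring

/-- The approximants are `χ(−1)`-symmetric. [folklore] -/
theorem approx_neg (hperx : ∀ s, x (s + 1) = x s) (hevenx : ∀ s, x (-s) = x s) (s : ℚ) (n : ℕ) :
    approx χ x ã (-s) n = χ (-1) * approx χ x ã s n := by
  simp only [approx, mul_neg, source_neg hperx hevenx, tail_neg hperx hevenx, mul_add, Finset.mul_sum]
  congr 1
  · exact Finset.sum_congr rfl fun j _ ↦ by ring
  · ring

/-- **PARITY OF THE FORCED PARTNER**: `Φ(−s) = χ(−1)·Φ(s)` for `x` even and `1`-periodic. [folklore] -/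
theorem forced_neg (hperx : ∀ s, x (s + 1) = x s) (hevenx : ∀ s, x (-s) = x s) (s : ℚ) :
    forced χ x ã (-s) = χ (-1) * forced χ x ã s := by
  simp only [forced, Rat.den_neg_eq_den, approx_neg hperx hevenx]

/-- **THE MEASURE OF THE FORCED PARTNER IS EVEN**: `μ(−a + p^{n+1}ℤ_p) = μ(a + p^{n+1}ℤ_p)` for
`μ = twistPartnerMeasure χ (forced χ x ã) ã x₀` and `x` even, `1`-periodic (`χ̄(−ā) = χ(−1)χ̄(ā)`,
`Φ(−s) = χ(−1)Φ(s)`, `χ(−1)² = 1`). [folklore] -/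
theorem twistPartnerMeasure_forced_neg (hperx : ∀ s, x (s + 1) = x s) (hevenx : ∀ s, x (-s) = x s)
    (x₀ : ℚ_[p]) (n : ℕ) (b : ZMod (p ^ (n + 1))) :
    twistPartnerMeasure χ (forced χ x ã) ã x₀ (n + 1) (-b) =
      twistPartnerMeasure χ (forced χ x ã) ã x₀ (n + 1) b := by
  haveI : NeZero (p ^ (n + 1)) := ⟨pow_ne_zero _ hp.out.ne_zero⟩
  have hper : ∀ s, forced χ x ã (s + 1) = forced χ x ã s := forced_add_one hperx
  simp only [twistPartnerMeasure_succ]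
  rw [ZMod.neg_val]
  split_ifs with hb
  · rw [hb, ZMod.val_zero]
  · have hle : b.val ≤ p ^ (n + 1) := (ZMod.val_lt b).le
    have hcast : (((p ^ (n + 1) - b.val : ℕ)) : ZMod p) = -1 * ((b.val : ℕ) : ZMod p) := by
      rw [Nat.cast_sub hle, Nat.cast_pow, pow_succ, ZMod.natCast_self, mul_zero, zero_sub,
        neg_one_mul]
    have hp0 : ((p : ℚ) ^ (n + 1)) ≠ 0 := pow_ne_zero _ (Nat.cast_ne_zero.mpr hp.out.ne_zero)
    have hq : (((p ^ (n + 1) - b.val : ℕ)) : ℚ) / (p : ℚ) ^ (n + 1) =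
        -((b.val : ℚ) / (p : ℚ) ^ (n + 1)) + ((1 : ℤ) : ℚ) := by
      rw [Nat.cast_sub hle, Nat.cast_pow]
      field_simp
      push_cast
      ring
    rw [hcast, map_mul, inv_apply_neg_one, hq, apply_add_intCast_of_periodic hper,
      forced_neg hperx hevenx]
    have h11 := apply_neg_one_mul_self χ
    linear_combination (ã⁻¹ ^ (n + 1) * χ⁻¹ ((b.val : ℕ) : ZMod p) *
      forced χ x ã ((b.val : ℚ) / (p : ℚ) ^ (n + 1))) * h11

end Parity

end TwistPartner

end Summit.BirchSwinnertonDyer.Rank1Residual.Additive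

end
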